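import Literature.MathematicalPhysics.QuantumFieldTheory.Balaban1983to89.Node00.BgHierFrameGLOfRecord
import Summits.QuantumFields.YangMills.Theorems.BalabanUVNodesN07QprOfRecordOnto
import Summits.QuantumFields.YangMills.Theorems.BalabanUVNodesN07QOfRecordInfGauge
import HarnessLib

/-!
# N07 — №608 (2) ONTO ROW, RECORD INSTANTIATION: at def-Y's COMPLETED (GL) hierarchical frame of record `hierFrameGLDatumOfRecord` ((A1′) `Node00/BgHierFrameGLOfRecord`), the all-matrix
# (3.114) token `FrameIntertwinesTok` HOLDS (def-Y's ✓`frameIntertwinesTok_hierFrameGL_of_scalarRow` + this lineage's un-framed all-matrix row ✓`N07QOfRecordInfGauge.qCplxOp_covGradM`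
# on the scalar channel), hence `Q^{pr}_k(1)` OF RECORD IS ONTO (`k ≤ m + K`) by ✓p829369 `QprOfRecord_one_surjective_of_intertwines` — the `hQ` binder of the framed triple at `U₀ = 1` DISCHARGED

Cell `pub-ymgap`, width seat `pub-ymgap-dag-n07-w3` (g28), INTENT-11 ∕ CLAIM-11 (the last item of this seat's №608 (2) share).  `--kind proof --supports stmt-QuantumFields-27238 --as helper`; count-neutral.
[B9] = [Balaban1985BackgroundPropagators]; [15] = [Balaban1985Variational]; [B7] = [Balaban1985Averaging].

WHAT (kernel, sorry-free, standard axioms; any `N`, any background `U₀` under the record's guard below `k` for §1–§2; `U₀ = 1` for §3).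
* §1 ★ `scalarRow_qCplxOp` — THE UN-FRAMED SCALAR ROW asked by def-Y's `…_of_scalarRow`: `q^{ff}_k(U₀)(D_{U₀}(φ·1))(c) = L^{-k}·(φ(emb^k c₊) − φ(emb^k c₋))·1` — this lineage's all-matrix
  ✓`qCplxOp_covGradM` at `λ := φ·1`, the conjugation `Ū(φ·1)Ū⋆ = φ·1` by unitarity.
* §2 ★★★ `frameIntertwinesTok_hierFrameGL` — `FrameIntertwinesTok F N k U₀ (hierFrameGLDatumOfRecord F N k U₀)` for EVERY matrix `λ` (def-Y's reduction + §1): the completed datum CARRIES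
  (A2)'s all-matrix token (the SL datum of (A1) does NOT — def-Y TRACE FLAG; nothing keyed on it here).
* §3 ★★★ `QprOfRecord_one_surjective_rec` — `Function.Surjective (QprOfRecord F N k 1 (hierFrameGLDatumOfRecord F N k 1))` for `k ≤ m + K`: ✓`QprOfRecord_one_surjective_of_intertwines` (q^{ff} onto +
  coarse-constant lift) at §2 with the guard ✓`smallBelow_avOfRecord_one` — the framed `hQ` at the flat background, by name.

HONEST LABELS.  By-name composition of landed theorems; onto at `U₀ = 1` only (the guarded small background is NOT claimed); the other admissibility binder `hpos` of the framed triple ([B9] Thm 3.11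
for `(Q^{pr}, Q′)`) is def-Y's (P3), untouched; nothing of Bałaban's estimates; count-neutral; K0ᴬ ⟨27238⟩ NOT closed; N07 NOT discharged; R4 is the conditional finite-𝕋⁴ rung `BalabanLadder.UV`
only; finite torus, fixed `ε` — nothing continuum ∕ OS ∕ Clay.  **The Yang–Mills mass gap is NOT proved by any of this.**  No `sorry`, no `def`, no `instance ∕ notation`; standard axioms.
-/

set_option autoImplicit false

noncomputable section

open scoped Matrix Matrix.Norms.L2Operator

namespace Summit.QuantumFields.YangMills.Theorems.N07QprOfRecordOntoAtRecord

open Literature.MathematicalPhysics.QuantumFieldTheory.Balaban1983to89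
open Literature.MathematicalPhysics.QuantumFieldTheory.Balaban1983to89.T4Continuum (T4Family)
open Literature.MathematicalPhysics.QuantumFieldTheory.Balaban1983to89.Node00
open B15DeterminingSets (embIter)
open Summit.QuantumFields.YangMills.Theorems.N07QOfRecordInfGauge (qCplxOp_covGradM)
open Summit.QuantumFields.YangMills.Theorems.N07QprOfRecordOnto (QprOfRecord_one_surjective_of_intertwines)

section Record

variable (F : T4Family) (N : ℕ) [NeZero N] (K : ℕ) (k : ℕ) (U₀ : GaugeField (F.P K) 0 (SU N))

/-- ★ **THE UN-FRAMED SCALAR ROW**: `q^{ff}_k(U₀)(D_{U₀}(φ·1))(c) = L^{-k}·(φ(emb^k c₊) − φ(emb^k c₋))·1` under the record's guard below `k` (✓`qCplxOp_covGradM` at `λ := φ·1`; the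
background average conjugation fixes scalars). [cite: Balaban1985BackgroundPropagators, (3.13)–(3.15) p.393; Balaban1985Averaging, (11) p.19] -/
theorem scalarRow_qCplxOp (hU₀ : SmallBelow (avOfRecord F N K) k U₀) (φ : Site (F.P K) 0 → ℂ) (c : PBond (F.P K) k) :
    qCplxOp k U₀ (fun b : PBond (F.P K) 0 =>
        (U₀ b : Matrix (Fin N) (Fin N) ℂ) * (φ b.tgt • (1 : Matrix (Fin N) (Fin N) ℂ)) * star (U₀ b : Matrix (Fin N) (Fin N) ℂ) -
          φ b.src • (1 : Matrix (Fin N) (Fin N) ℂ)) c =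
      (((F.P K).L : ℂ) ^ k)⁻¹ • ((φ (embIter k c.tgt) - φ (embIter k c.src)) • (1 : Matrix (Fin N) (Fin N) ℂ)) := by
  have h := qCplxOp_covGradM (P := F.P K) (N := N) (U₀ := U₀) (k := k) hU₀ (fun x => φ x • (1 : Matrix (Fin N) (Fin N) ℂ)) c
  rw [h]
  congr 1
  rw [Matrix.mul_smul, Matrix.smul_mul, Matrix.mul_one, coe_mul_star_coe_SU, sub_smul]

/-- ★★★ **THE COMPLETED FRAME OF RECORD CARRIES THE ALL-MATRIX (3.114) TOKEN**: `FrameIntertwinesTok F N k U₀ (hierFrameGLDatumOfRecord F N k U₀)` under the guard below `k`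
(def-Y's ✓`frameIntertwinesTok_hierFrameGL_of_scalarRow` + §1). [cite: Balaban1985BackgroundPropagators, (3.113)–(3.115) p.418, (3.18)–(3.19) p.393; Balaban1985Averaging, (84)–(92) pp.30–31] -/
theorem frameIntertwinesTok_hierFrameGL (hU₀ : SmallBelow (avOfRecord F N K) k U₀) :
    FrameIntertwinesTok F N k U₀ (hierFrameGLDatumOfRecord F N k U₀) :=
  frameIntertwinesTok_hierFrameGL_of_scalarRow F N k U₀ hU₀ (scalarRow_qCplxOp F N K k U₀ hU₀)

/-- ★★★ **`Q^{pr}_k(1)` OF RECORD IS ONTO** (`k ≤ m + K`): `Function.Surjective (QprOfRecord F N k 1 (hierFrameGLDatumOfRecord F N k 1))` — the `hQ` binder of the framed triple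
`frakGprOfRecordAtBg ∕ H1prOfRecordAtBg … hpos hQ` at the flat background DISCHARGED: ✓`QprOfRecord_one_surjective_of_intertwines` («`q^{ff}` onto + coarse-constant lift») at §2 with the guard
✓`smallBelow_avOfRecord_one`. [cite: Balaban1985Variational, (45) p.285, (103) p.293; Balaban1985BackgroundPropagators, (3.113)–(3.115) p.418, (3.13)–(3.15) p.393] -/
theorem QprOfRecord_one_surjective_rec (hk : k ≤ (F.P K).m + (F.P K).K) :
    Function.Surjective (QprOfRecord F N k (1 : GaugeField (F.P K) 0 (SU N)) (hierFrameGLDatumOfRecord F N k (1 : GaugeField (F.P K) 0 (SU N)))) :=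
  QprOfRecord_one_surjective_of_intertwines F N K (hierFrameGLDatumOfRecord F N k (1 : GaugeField (F.P K) 0 (SU N))) hk
    (frameIntertwinesTok_hierFrameGL F N K k (1 : GaugeField (F.P K) 0 (SU N)) (smallBelow_avOfRecord_one F N k))

end Record

end Summit.QuantumFields.YangMills.Theorems.N07QprOfRecordOntoAtRecord

end
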